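import Summits.CriticalPhenomena.PercolationContinuityZ3.Theorems.PercNearOneGluingNoHeavyLowerTailSahiHubTwoLevelCrossForm
import Mathlib.Tactic.Linarith
import Mathlib.Tactic.Positivity
import Mathlib.Tactic.Ring
import HarnessLib

/-!
# `NoHeavyLowerTail` (crux stmt-CriticalPhenomena-4575), P2 — THE SQUARE (ANTIPODAL) IDENTITY FOR THE BIAS-FREE CROSS FORM `I3`

Seat `prim-masterthm-p2`, gen 29 (memo `FROM-prim-masterthm-p2-g29-SQUARE-IDENTITY.md`; `--supports stmt-CriticalPhenomena-4575`).
No `sorry`, no named facts, standard axioms.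

SETTING (`…SahiHubTwoLevel`, `…CrossForm`): FKG blocks `α, β` (weights `wA, wB`), hub coin `z ∈ Fin 2`, private f–g coin
`c ∈ Fin 2`; sections `f i z : α → ℝ` (`i` = c-level), `g j z : β → ℝ`, `h z : α → β → ℝ`.  Index the four points of the
(z,c)-SQUARE by `x = (i,z)`: `0 = (0,0)`, `C = (1,0)`, `Z = (0,1)`, `T = (1,1)`, with ANTIPODE `x̄ = (1−i,1−z)` (`0 ↔ T`, `Z ↔ C`);
`F_x = Fm i z`, `G_x = gm i z`, slices `Y_x(b) = Ysl i z b = E_a[f_x h_z(·,b)]`, `H_z(b) = Hsl z b`, `Ȳ_x = Ybar i z`, `H̄_z = Hb z`.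
The bias-free cross form is `I3 = crossForm = L(0;1) + L(1;0) − N·H̄₁`; `T₁(|C|=1) ⟸ I3 ≥ 0` is `twoLevel_nonneg_of_crossForm_nonneg'`.

* `Sbox ρ b` — the ANTIPODAL SUM at the fibre `b` for a ratio `ρ : square → ℝ`:
  `S^ρ(b) = Σ_x g_x(b)·[(2−ρ_x)Y_x(b) − F_x̄·H_{z(x)}(b) − (1−ρ_x̄)·Y_x̄(b)]` (the `SahiBox` antipodal pairing on the box `{z,c}`).
* `CPart ρ` — `Σ_x [ρ_x·Cov_b(g_x,Y_x) + (1−ρ_x)·Cov_b(g_x̄,Y_x)]`;  `Rpart ρ` — the ENVIRONMENT REMAINDER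
  `Σ_x ρ_x(G_x−G_x̄)Ȳ_x − (F_T−F_Z)(G_T−G_Z)H̄₀ − [(F_C−F_0)(G_C−G_0) + N]·H̄₁`.
* **`crossForm_eq_square` (THE SQUARE IDENTITY, any `ρ`, pure algebra):  `I3 = Σ_b wB(b)·S^ρ(b) + CPart ρ + Rpart ρ`.**
* `Rpart_eq`: `Rpart ρ = (G_T−G_0)·D_{T0} + (G_Z−G_C)·D_{ZC} + (F_T−F_Z)(G_T−G_Z)(H̄₁−H̄₀)` with
  `D_{T0} = ρ_TȲ_T − ρ_0Ȳ_0 − (F_T−F_0)H̄₁`, `D_{ZC} = ρ_ZȲ_Z − ρ_CȲ_C − (F_Z−F_C)H̄₁` (`DT0`, `DZC`).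
* `CPart_nonneg`: `CPart ρ ≥ 0` for `ρ ∈ [0,1]^4` (FKG on `β`: every `Y_x(·)` is increasing in `b`).
* **`crossForm_nonneg_of_square` (THE CRITERION):** if some `ρ ∈ [0,1]^4` has `S^ρ(b) ≥ 0` at every fibre `b` and
  `Rpart ρ ≥ 0`, then `I3 ≥ 0`.
Also the fibre facts used downstream: the slice bound `Fm·Hsl ≤ Ysl` (FKG on `α`), monotonicity of `Ysl` along the square,
and their averages.  The companion file `…SahiHubTwoLevelI3` exhibits, for EVERY datum, an explicit `ρ = ρ(F, sign(G_Z−G_C))`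
satisfying the criterion — so that `I3 ≥ 0`, T₁(|C|=1) and Kahn's `C₃` on that class become unconditional.
With `h 0 = h 1` and the class-T ratio `ρ_x = F_xH̄/Ȳ_x` one has `Rpart = 0`: this is SAHI-ROUTE §4.33 (block comb-positivity on
class T) read on the box `{z,c}`.  HONEST LABEL: identity + criterion (this file); the proof of `I3 ≥ 0` is in the companion. [this work]
-/

noncomputable section

open scoped Classical

namespace Summit.CriticalPhenomena.PercolationContinuityZ3.Theorems

namespace SahiHubTwoLevel

open Finset Literature.Combinatorics.Sahi2008
open SahiTriangleSupermodular (fkg_sum)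

section Defs

variable {α β : Type} [Fintype α] [Fintype β]
  (wA : α → ℝ) (wB : β → ℝ) (f : Fin 2 → Fin 2 → α → ℝ) (g : Fin 2 → Fin 2 → β → ℝ) (h : Fin 2 → α → β → ℝ)

/-- Mixed moment `M(i,z; i',z') = E_b[g_{i z}(b)·Y_{i' z'}(b)] = E[g_{iz} f_{i'z'} h_{z'}]` (the two square points may differ). [this work] -/
def Mgy (i z i' z' : Fin 2) : ℝ := ∑ b, wB b * (g i z b * Ysl wA f h i' z' b)

/-- Mixed moment `N(i,z; z') = E_b[g_{i z}(b)·H_{z'}(b)] = E[g_{iz} h_{z'}]`. [this work] -/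
def Ngh (i z z' : Fin 2) : ℝ := ∑ b, wB b * (g i z b * Hsl wA h z' b)

/-- Fibre covariance `Cov_b(g_{i z}, Y_{i' z'}) = M(i,z;i',z') − G_{iz}·Ȳ_{i'z'}`. [this work] -/
def covGY (i z i' z' : Fin 2) : ℝ := Mgy wA wB f g h i z i' z' - gm wB g i z * Ybar wA wB f h i' z'

variable (ρ : Fin 2 → Fin 2 → ℝ)

/-- **The antipodal sum at a fibre** `S^ρ(b) = Σ_x g_x(b)[(2−ρ_x)Y_x(b) − F_x̄ H_{z(x)}(b) − (1−ρ_x̄)Y_x̄(b)]`, the four square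
points `x = (i,z)` written out (`T=(1,1)`, `Z=(0,1)`, `C=(1,0)`, `0=(0,0)`; antipode `(1−i,1−z)`). [this work] -/
def Sbox (b : β) : ℝ :=
  g 1 1 b * ((2 - ρ 1 1) * Ysl wA f h 1 1 b - Fm wA f 0 0 * Hsl wA h 1 b - (1 - ρ 0 0) * Ysl wA f h 0 0 b)
  + g 0 1 b * ((2 - ρ 0 1) * Ysl wA f h 0 1 b - Fm wA f 1 0 * Hsl wA h 1 b - (1 - ρ 1 0) * Ysl wA f h 1 0 b)
  + g 1 0 b * ((2 - ρ 1 0) * Ysl wA f h 1 0 b - Fm wA f 0 1 * Hsl wA h 0 b - (1 - ρ 0 1) * Ysl wA f h 0 1 b)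
  + g 0 0 b * ((2 - ρ 0 0) * Ysl wA f h 0 0 b - Fm wA f 1 1 * Hsl wA h 0 b - (1 - ρ 1 1) * Ysl wA f h 1 1 b)

/-- **The covariance part** `CP(ρ) = Σ_x [ρ_x Cov_b(g_x,Y_x) + (1−ρ_x) Cov_b(g_x̄,Y_x)]`. [this work] -/
def CPart : ℝ :=
  ρ 1 1 * covGY wA wB f g h 1 1 1 1 + (1 - ρ 1 1) * covGY wA wB f g h 0 0 1 1
  + ρ 0 1 * covGY wA wB f g h 0 1 0 1 + (1 - ρ 0 1) * covGY wA wB f g h 1 0 0 1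
  + ρ 1 0 * covGY wA wB f g h 1 0 1 0 + (1 - ρ 1 0) * covGY wA wB f g h 0 1 1 0
  + ρ 0 0 * covGY wA wB f g h 0 0 0 0 + (1 - ρ 0 0) * covGY wA wB f g h 1 1 0 0

/-- **The environment remainder** `R(ρ) = Σ_x ρ_x(G_x − G_x̄)Ȳ_x − (F_T−F_Z)(G_T−G_Z)H̄₀ − [(F_C−F_0)(G_C−G_0) + N]H̄₁`
(`N = crossN`); it involves only section means, slice masses `Ȳ_x` and the two levels of `E h`. [this work] -/
def Rpart : ℝ :=
  ρ 1 1 * (gm wB g 1 1 - gm wB g 0 0) * Ybar wA wB f h 1 1 + ρ 0 0 * (gm wB g 0 0 - gm wB g 1 1) * Ybar wA wB f h 0 0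
  + ρ 0 1 * (gm wB g 0 1 - gm wB g 1 0) * Ybar wA wB f h 0 1 + ρ 1 0 * (gm wB g 1 0 - gm wB g 0 1) * Ybar wA wB f h 1 0
  - (Fm wA f 1 1 - Fm wA f 0 1) * (gm wB g 1 1 - gm wB g 0 1) * Hb wA wB h 0
  - ((Fm wA f 1 0 - Fm wA f 0 0) * (gm wB g 1 0 - gm wB g 0 0) + crossN wA wB f g) * Hb wA wB h 1

/-- `D_{T0}(ρ) = ρ_TȲ_T − ρ_0Ȳ_0 − (F_T − F_0)H̄₁` (excess of the antipodal pair `T ↔ 0`). [this work] -/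
def DT0 : ℝ := ρ 1 1 * Ybar wA wB f h 1 1 - ρ 0 0 * Ybar wA wB f h 0 0 - (Fm wA f 1 1 - Fm wA f 0 0) * Hb wA wB h 1

/-- `D_{ZC}(ρ) = ρ_ZȲ_Z − ρ_CȲ_C − (F_Z − F_C)H̄₁` (excess of the antipodal pair `Z ↔ C`). [this work] -/
def DZC : ℝ := ρ 0 1 * Ybar wA wB f h 0 1 - ρ 1 0 * Ybar wA wB f h 1 0 - (Fm wA f 0 1 - Fm wA f 1 0) * Hb wA wB h 1

end Defs

section Identity

variable {α β : Type} [Fintype α] [Fintype β]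
  {wA : α → ℝ} {wB : β → ℝ} {f : Fin 2 → Fin 2 → α → ℝ} {g : Fin 2 → Fin 2 → β → ℝ} {h : Fin 2 → α → β → ℝ}
  {ρ : Fin 2 → Fin 2 → ℝ}

/-- `Σ_b wB S^ρ(b)` in the mixed moments. [this work] -/
theorem sum_Sbox :
    (∑ b, wB b * Sbox wA f g h ρ b) =
      (2 - ρ 1 1) * Mgy wA wB f g h 1 1 1 1 - Fm wA f 0 0 * Ngh wA wB g h 1 1 1 - (1 - ρ 0 0) * Mgy wA wB f g h 1 1 0 0
      + ((2 - ρ 0 1) * Mgy wA wB f g h 0 1 0 1 - Fm wA f 1 0 * Ngh wA wB g h 0 1 1 - (1 - ρ 1 0) * Mgy wA wB f g h 0 1 1 0)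
      + ((2 - ρ 1 0) * Mgy wA wB f g h 1 0 1 0 - Fm wA f 0 1 * Ngh wA wB g h 1 0 0 - (1 - ρ 0 1) * Mgy wA wB f g h 1 0 0 1)
      + ((2 - ρ 0 0) * Mgy wA wB f g h 0 0 0 0 - Fm wA f 1 1 * Ngh wA wB g h 0 0 0 - (1 - ρ 1 1) * Mgy wA wB f g h 0 0 1 1) := by
  have e : ∀ b, wB b * Sbox wA f g h ρ b =
      (2 - ρ 1 1) * (wB b * (g 1 1 b * Ysl wA f h 1 1 b)) - Fm wA f 0 0 * (wB b * (g 1 1 b * Hsl wA h 1 b))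
        - (1 - ρ 0 0) * (wB b * (g 1 1 b * Ysl wA f h 0 0 b))
      + ((2 - ρ 0 1) * (wB b * (g 0 1 b * Ysl wA f h 0 1 b)) - Fm wA f 1 0 * (wB b * (g 0 1 b * Hsl wA h 1 b))
        - (1 - ρ 1 0) * (wB b * (g 0 1 b * Ysl wA f h 1 0 b)))
      + ((2 - ρ 1 0) * (wB b * (g 1 0 b * Ysl wA f h 1 0 b)) - Fm wA f 0 1 * (wB b * (g 1 0 b * Hsl wA h 0 b))
        - (1 - ρ 0 1) * (wB b * (g 1 0 b * Ysl wA f h 0 1 b)))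
      + ((2 - ρ 0 0) * (wB b * (g 0 0 b * Ysl wA f h 0 0 b)) - Fm wA f 1 1 * (wB b * (g 0 0 b * Hsl wA h 0 b))
        - (1 - ρ 1 1) * (wB b * (g 0 0 b * Ysl wA f h 1 1 b))) := fun b => by
    unfold Sbox; ring
  simp only [e, sum_add_distrib, sum_sub_distrib, ← mul_sum]
  rfl

/-- The same-point mixed moments are the tree's `Sgy`, `Sgh`. [this work] -/
theorem Mgy_self (i j z : Fin 2) : Mgy wA wB f g h j z i z = Sgy wA wB f g h i j z := rfl

/-- The same-level `Ngh` is the tree's `Sgh`. [this work] -/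
theorem Ngh_self (j z : Fin 2) : Ngh wA wB g h j z z = Sgh wA wB g h j z := rfl

/-- **THE SQUARE IDENTITY**: `I3 = Σ_b wB(b)·S^ρ(b) + CPart ρ + Rpart ρ` for EVERY `ρ` (pure bookkeeping; no hypothesis). [this work] -/
theorem crossForm_eq_square (ρ : Fin 2 → Fin 2 → ℝ) :
    crossForm wA wB f g h = (∑ b, wB b * Sbox wA f g h ρ b) + CPart wA wB f g h ρ + Rpart wA wB f g h ρ := by
  rw [sum_Sbox]
  unfold crossForm levelForm CPart covGY Rpart crossN
  simp only [← Mgy_self, ← Ngh_self]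
  ring

/-- **`R = (G_T−G_0)·D_{T0} + (G_Z−G_C)·D_{ZC} + (F_T−F_Z)(G_T−G_Z)(H̄₁−H̄₀)`** (pure algebra). [this work] -/
theorem Rpart_eq (ρ : Fin 2 → Fin 2 → ℝ) :
    Rpart wA wB f g h ρ = (gm wB g 1 1 - gm wB g 0 0) * DT0 wA wB f h ρ + (gm wB g 0 1 - gm wB g 1 0) * DZC wA wB f h ρ
      + (Fm wA f 1 1 - Fm wA f 0 1) * (gm wB g 1 1 - gm wB g 0 1) * (Hb wA wB h 1 - Hb wA wB h 0) := by
  unfold Rpart DT0 DZC crossN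
  ring

end Identity

section Positivity

variable {α β : Type} [Fintype α] [Fintype β]
  {wA : α → ℝ} {wB : β → ℝ} {f : Fin 2 → Fin 2 → α → ℝ} {g : Fin 2 → Fin 2 → β → ℝ} {h : Fin 2 → α → β → ℝ}

omit [Fintype β] in
/-- Every slice `b ↦ Y_x(b)` is increasing (for `wA ≥ 0`, `f ≥ 0`, `h` increasing in `b`). [this work] -/
theorem Ysl_mono_b [Preorder β] (hA0 : ∀ a, 0 ≤ wA a) (hf0 : ∀ i z a, 0 ≤ f i z a) (hhb : ∀ z a, Monotone (h z a))
    (i z : Fin 2) : Monotone (Ysl wA f h i z) := fun _ _ hbb' =>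
  sum_le_sum fun a _ => mul_le_mul_of_nonneg_left (mul_le_mul_of_nonneg_left (hhb z a hbb') (hf0 i z a)) (hA0 a)

omit [Fintype β] in
/-- Slices are nonnegative. [this work] -/
theorem Ysl_nonneg (hA0 : ∀ a, 0 ≤ wA a) (hf0 : ∀ i z a, 0 ≤ f i z a) (hh0 : ∀ z a b, 0 ≤ h z a b) (i z : Fin 2) (b : β) :
    0 ≤ Ysl wA f h i z b := sum_nonneg fun a _ => mul_nonneg (hA0 a) (mul_nonneg (hf0 i z a) (hh0 z a b))

omit [Fintype β] in
/-- `H_z(b) ≥ 0`. [this work] -/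
theorem Hsl_nonneg (hA0 : ∀ a, 0 ≤ wA a) (hh0 : ∀ z a b, 0 ≤ h z a b) (z : Fin 2) (b : β) : 0 ≤ Hsl wA h z b :=
  sum_nonneg fun a _ => mul_nonneg (hA0 a) (hh0 z a b)

/-- **Fibre covariances are nonnegative**: `Cov_b(g_{iz}, Y_{i'z'}) ≥ 0` (FKG on `β`). [this work] -/
theorem covGY_nonneg [DistribLattice β] (hB : IsFKGMeasure wB) (hA0 : ∀ a, 0 ≤ wA a)
    (hf0 : ∀ i z a, 0 ≤ f i z a) (hg0 : ∀ j z b, 0 ≤ g j z b) (hgb : ∀ j z, Monotone (g j z))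
    (hh0 : ∀ z a b, 0 ≤ h z a b) (hhb : ∀ z a, Monotone (h z a)) (i z i' z' : Fin 2) :
    0 ≤ covGY wA wB f g h i z i' z' := by
  unfold covGY Mgy gm Ybar
  exact sub_nonneg.2 (fkg_sum hB (hg0 i z) (Ysl_nonneg hA0 hf0 hh0 i' z') (hgb i z) (Ysl_mono_b hA0 hf0 hhb i' z'))

/-- **`CPart ρ ≥ 0` for `ρ ∈ [0,1]^4`.** [this work] -/
theorem CPart_nonneg [DistribLattice β] (hB : IsFKGMeasure wB) (hA0 : ∀ a, 0 ≤ wA a)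
    (hf0 : ∀ i z a, 0 ≤ f i z a) (hg0 : ∀ j z b, 0 ≤ g j z b) (hgb : ∀ j z, Monotone (g j z))
    (hh0 : ∀ z a b, 0 ≤ h z a b) (hhb : ∀ z a, Monotone (h z a))
    {ρ : Fin 2 → Fin 2 → ℝ} (hρ0 : ∀ i z, 0 ≤ ρ i z) (hρ1 : ∀ i z, ρ i z ≤ 1) : 0 ≤ CPart wA wB f g h ρ := by
  have c := covGY_nonneg hB hA0 hf0 hg0 hgb hh0 hhb
  unfold CPart
  have := hρ0 1 1; have := hρ1 1 1; have := hρ0 0 1; have := hρ1 0 1; have := hρ0 1 0; have := hρ1 1 0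
  have := hρ0 0 0; have := hρ1 0 0
  have := c 1 1 1 1; have := c 0 0 1 1; have := c 0 1 0 1; have := c 1 0 0 1; have := c 1 0 1 0; have := c 0 1 1 0
  have := c 0 0 0 0; have := c 1 1 0 0
  have t1 := mul_nonneg (hρ0 1 1) (c 1 1 1 1); have t2 := mul_nonneg (sub_nonneg.2 (hρ1 1 1)) (c 0 0 1 1)
  have t3 := mul_nonneg (hρ0 0 1) (c 0 1 0 1); have t4 := mul_nonneg (sub_nonneg.2 (hρ1 0 1)) (c 1 0 0 1)
  have t5 := mul_nonneg (hρ0 1 0) (c 1 0 1 0); have t6 := mul_nonneg (sub_nonneg.2 (hρ1 1 0)) (c 0 1 1 0)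
  have t7 := mul_nonneg (hρ0 0 0) (c 0 0 0 0); have t8 := mul_nonneg (sub_nonneg.2 (hρ1 0 0)) (c 1 1 0 0)
  linarith

omit [Fintype β] in
/-- **THE SLICE BOUND** (FKG on `α` in the fibre over `b`): `F_x · H_{z(x)}(b) ≤ Y_x(b)`. [this work] -/
theorem Fm_mul_Hsl_le_Ysl [DistribLattice α] (hA : IsFKGMeasure wA) (hf0 : ∀ i z a, 0 ≤ f i z a)
    (hfa : ∀ i z, Monotone (f i z)) (hh0 : ∀ z a b, 0 ≤ h z a b) (hha : ∀ z b, Monotone (fun a => h z a b))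
    (i z : Fin 2) (b : β) : Fm wA f i z * Hsl wA h z b ≤ Ysl wA f h i z b := by
  unfold Fm Hsl Ysl
  exact fkg_sum hA (hf0 i z) (hh0 z · b) (hfa i z) (hha z b)

/-- The averaged slice bound: `F_x · H̄_{z(x)} ≤ Ȳ_x`. [this work] -/
theorem Fm_mul_Hb_le_Ybar [DistribLattice α] (hA : IsFKGMeasure wA) (hB0 : ∀ b, 0 ≤ wB b) (hf0 : ∀ i z a, 0 ≤ f i z a)
    (hfa : ∀ i z, Monotone (f i z)) (hh0 : ∀ z a b, 0 ≤ h z a b) (hha : ∀ z b, Monotone (fun a => h z a b))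
    (i z : Fin 2) : Fm wA f i z * Hb wA wB h z ≤ Ybar wA wB f h i z := by
  unfold Hb Ybar
  rw [mul_sum]
  exact sum_le_sum fun b _ => by
    have := mul_le_mul_of_nonneg_left (Fm_mul_Hsl_le_Ysl hA hf0 hfa hh0 hha i z b) (hB0 b)
    linarith [this]

omit [Fintype β] in
/-- Monotonicity of the slices along the c-direction: `Y_{0z}(b) ≤ Y_{1z}(b)` for nested sections. [this work] -/
theorem Ysl_mono_i (hA0 : ∀ a, 0 ≤ wA a) (hfi : ∀ z a, f 0 z a ≤ f 1 z a) (hh0 : ∀ z a b, 0 ≤ h z a b) (z : Fin 2) (b : β) :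
    Ysl wA f h 0 z b ≤ Ysl wA f h 1 z b :=
  sum_le_sum fun a _ => mul_le_mul_of_nonneg_left (mul_le_mul_of_nonneg_right (hfi z a) (hh0 z a b)) (hA0 a)

omit [Fintype β] in
/-- Monotonicity of the slices along the hub direction: `Y_{i0}(b) ≤ Y_{i1}(b)` (sections and `h` increasing in `z`). [this work] -/
theorem Ysl_mono_z (hA0 : ∀ a, 0 ≤ wA a) (hf0 : ∀ i z a, 0 ≤ f i z a) (hfz : ∀ i a, f i 0 a ≤ f i 1 a)
    (hh0 : ∀ z a b, 0 ≤ h z a b) (hhz : ∀ a b, h 0 a b ≤ h 1 a b) (i : Fin 2) (b : β) :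
    Ysl wA f h i 0 b ≤ Ysl wA f h i 1 b :=
  sum_le_sum fun a _ => mul_le_mul_of_nonneg_left
    (mul_le_mul (hfz i a) (hhz a b) (hh0 0 a b) (hf0 i 1 a)) (hA0 a)

omit [Fintype β] in
/-- `H_0(b) ≤ H_1(b)`. [this work] -/
theorem Hsl_mono_z (hA0 : ∀ a, 0 ≤ wA a) (hhz : ∀ a b, h 0 a b ≤ h 1 a b) (b : β) : Hsl wA h 0 b ≤ Hsl wA h 1 b :=
  sum_le_sum fun a _ => mul_le_mul_of_nonneg_left (hhz a b) (hA0 a)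

/-- Averages of monotone slices: `Ȳ_{0z} ≤ Ȳ_{1z}`. [this work] -/
theorem Ybar_mono_i (hA0 : ∀ a, 0 ≤ wA a) (hB0 : ∀ b, 0 ≤ wB b) (hfi : ∀ z a, f 0 z a ≤ f 1 z a)
    (hh0 : ∀ z a b, 0 ≤ h z a b) (z : Fin 2) : Ybar wA wB f h 0 z ≤ Ybar wA wB f h 1 z :=
  sum_le_sum fun b _ => mul_le_mul_of_nonneg_left (Ysl_mono_i hA0 hfi hh0 z b) (hB0 b)

/-- Averages of monotone slices: `Ȳ_{i0} ≤ Ȳ_{i1}`. [this work] -/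
theorem Ybar_mono_z (hA0 : ∀ a, 0 ≤ wA a) (hB0 : ∀ b, 0 ≤ wB b) (hf0 : ∀ i z a, 0 ≤ f i z a) (hfz : ∀ i a, f i 0 a ≤ f i 1 a)
    (hh0 : ∀ z a b, 0 ≤ h z a b) (hhz : ∀ a b, h 0 a b ≤ h 1 a b) (i : Fin 2) :
    Ybar wA wB f h i 0 ≤ Ybar wA wB f h i 1 :=
  sum_le_sum fun b _ => mul_le_mul_of_nonneg_left (Ysl_mono_z hA0 hf0 hfz hh0 hhz i b) (hB0 b)

/-- **THE CRITERION.**  If `ρ ∈ [0,1]^4` makes the antipodal sum nonnegative at every fibre and the environment remainder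
nonnegative, then `I3 = crossForm ≥ 0` (hence `twoLevel ≥ 0` at every hub bias, `…OneLevelLaw`). [this work] -/
theorem crossForm_nonneg_of_square [DistribLattice β] (hB : IsFKGMeasure wB) (hA0 : ∀ a, 0 ≤ wA a)
    (hf0 : ∀ i z a, 0 ≤ f i z a) (hg0 : ∀ j z b, 0 ≤ g j z b) (hgb : ∀ j z, Monotone (g j z))
    (hh0 : ∀ z a b, 0 ≤ h z a b) (hhb : ∀ z a, Monotone (h z a))
    {ρ : Fin 2 → Fin 2 → ℝ} (hρ0 : ∀ i z, 0 ≤ ρ i z) (hρ1 : ∀ i z, ρ i z ≤ 1)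
    (hS : ∀ b, 0 ≤ Sbox wA f g h ρ b) (hR : 0 ≤ Rpart wA wB f g h ρ) : 0 ≤ crossForm wA wB f g h := by
  rw [crossForm_eq_square ρ]
  have h1 : 0 ≤ ∑ b, wB b * Sbox wA f g h ρ b := sum_nonneg fun b _ => mul_nonneg (hB.nonneg b) (hS b)
  have h2 := CPart_nonneg hB hA0 hf0 hg0 hgb hh0 hhb hρ0 hρ1
  linarith

end Positivity

end SahiHubTwoLevel

end Summit.CriticalPhenomena.PercolationContinuityZ3.Theorems
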